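import Literature.NumberTheory.EllipticCurves.CasselsTateAlternating
import HarnessLib

/-!
# The level-`m` Cassels–Tate pairing on `Ш(E/K)[m]` is ALTERNATING: `B_m(x, x) = 0`

Companion of `CasselsTateAlternating` (Cassels' theorem for the tree's general-case pairing:
`ctGeneralFun_self_eq_zero`, `⟨a, a⟩ = 0` for `a ∈ Ш(E/K)` with `m • a = 0`, at every level `m`) and
`CasselsTateLevelAssembly` (`ctLevelPairing`: the pairing on `Ш(E/K)[m]` with values in `ℚ/ℤ`,
`B_m(x, y) = ⟨x, y⟩/m²`). This file records the one-line consequence in the currency consumers use: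

* `ctLevelPairing_self_eq_zero` — `B_m(x, x) = 0` for every `x ∈ Ш(E/K)[m]` (any number field, any
  elliptic curve, any `m ≥ 1`, any local-invariant data with reciprocity and `Ш³(K, μ_{m²}) = 0`).

Used by the BSD route `CMKolyvaginAtInertTwo` (crux `CMKolyvaginExactAtInertTwo`): the two alternation
inputs `hB₁alt`, `hB₂alt` of `KolyvaginPairDataTwo.card_mul_card_le_two_pow_two_mul_of_pairData_canonical`.
No named fact; nothing here is a claim about BSD.

## References

* J. W. S. Cassels, *Arithmetic on curves of genus 1, IV. Proof of the Hauptvermutung*, J. reine angew.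
  Math. 211 (1962): §1 (the pairing on Ш is alternating). [Cassels1962ArithmeticIV]
* J. S. Milne, *Arithmetic Duality Theorems* (2006): Ch. I §6, Prop. 6.9, Thm. 6.13 (a). [MilneADT2006]
-/

noncomputable section

open scoped Classical
open scoped AddSubgroup

universe u

namespace Literature.NumberTheory.EllipticCurves

open _root_.WeierstrassCurve Field Function NumberField
open Literature.NumberTheory.GaloisRepresentations Literature.NumberTheory.GaloisCohomology
open Literature.NumberTheory.GaloisRepresentations.DiscreteGaloisModule (mu)

variable {K : Type u} [Field K] [NumberField K] (W : WeierstrassCurve K) [W.IsElliptic] (m : ℕ) [NeZero m]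
variable (e : geomTorsion W ((m * m : ℕ) : ℤ) → geomTorsion W ((m * m : ℕ) : ℤ) → AlgebraicClosure K)
  (hμ : ∀ S T, e S T ^ (m * m) = 1)
  (hadd₁ : ∀ S₁ S₂ T, e (S₁ + S₂) T = e S₁ T * e S₂ T)
  (hadd₂ : ∀ S T₁ T₂, e S (T₁ + T₂) = e S T₁ * e S T₂)
  (hgal : ∀ (σ : absoluteGaloisGroup K) (S T : geomTorsion W ((m * m : ℕ) : ℤ)), σ • e S T = e (σ • S) (σ • T))
  (inv : LocalInvariants K (m * m)) (halt : ∀ T, e T T = 1) (hPT' : inv.SumInvLocalizationEqZero)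
  (hH3 : ∀ c : galoisCohomology (mu K (m * m)) 3,
    (∀ v : Place K, galoisCohomology.localization (mu K (m * m)) v 3 c = 0) → c = 0)
  (hfin : ∀ D : GeneralCaseData W m e hμ hadd₁ hadd₂ hgal, ∃ S : Finset (Place K), ∀ v ∉ S, D.localTerm inv v = 0)

/-- **The level-`m` Cassels–Tate pairing is alternating**: `B_m(x, x) = 0` for `x ∈ Ш(E/K)[m]` — Cassels'
theorem `ctGeneralFun_self_eq_zero` read through `B_m = zmodToCircle ∘ ctGeneralFun` (`ctLevelPairing_apply`).
[cite: Cassels1962ArithmeticIV, §1 (the pairing on Ш of an elliptic curve is alternating)] [cite: MilneADT2006, Ch. I §6, Prop. 6.9] -/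
theorem ctLevelPairing_self_eq_zero (x : (W.sha)[m]) :
    ctLevelPairing W m e hμ hadd₁ hadd₂ hgal inv halt hPT' hH3 hfin x x = 0 := by
  rw [ctLevelPairing_apply, ctGeneralFun_self_eq_zero halt inv hPT' hH3 (shaTorsionVal_mem W m x)
    (zsmul_shaTorsionVal W m x), map_zero]

end Literature.NumberTheory.EllipticCurves

end
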